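import Literature.Analysis.FluidPDE.PerturbedNSFourierTimeRegularity
import Literature.Analysis.FluidPDE.PerturbedNSFourierSymmetry
import Literature.Analysis.FluidPDE.LinearisedNSFourierData
import HarnessLib

/-!
# Fourier-side data of the perturbed Navier–Stokes system for a smooth background and datum

Analysis/FluidPDE proof file, sequel of `PerturbedNSFourierTimeRegularity` and
`PerturbedNSFourierSymmetry` in the chain `PerturbedNSFourier*` (short-time smooth solutions
of `∂ₜv + (v·∇)v + (u·∇)v + (v·∇)u + ∇q = νΔv`, `div v = 0`, `v(0) = v₀` around a smooth
divergence-free background on `T^d`, `#d ≤ 3`; Majda–Bertozzi 2002, Thm. 3.4; Cheskidov–Luo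
2022, §3.1 (3.2)). For a background velocity `u` jointly smooth and divergence free on
`[0, θ] × T^d` and a smooth, divergence-free, mean-zero datum `v₀`, the Fourier-side data
`U = CorrectorFourier.driftCoeff θ u` (reused from the Cheskidov–Luo construction,
`CorrectorFourierData`) and `a = LinearisedNSFourier.datumCoeff v₀` (reused from the linearised
construction, `LinearisedNSFourierData`) satisfy:

* `datumCoeff_neg_eq_conj` — conjugation symmetry of the datum coefficients (the datum is real);
* `picardHyp`, `ballHyp` — the qualitative hypotheses `PicardHyp ν θ U a` (`ν > 0`,
  `0 < θ ≤ 1`) and, given the threshold numbers, the quantitative ones `BallHyp ν θ U a Z ρ A`;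
* `solCoeff_spec` — the package of Fourier-side properties of the solution coefficients
  `c = solCoeff ν θ u v₀` under `BallHyp` (continuity, every decay, divergence freedom, zero
  mode, conjugation symmetry, the datum, the differentiated mild equation on `[0, θ]`,
  coefficient families of every order);
* `exists_presFamily` — the pressure coefficients `presCoeffField ν θ u v₀` start a coefficient
  family of every order (as `CorrectorFourier.exists_presFamily`).

## References

* A. J. Majda, A. L. Bertozzi, *Vorticity and Incompressible Flow*, CUP 2002, Thm. 3.4. [`MajdaBertozziCUP2002`]
* A. Cheskidov, X. Luo, arXiv:2009.06596, §3.1 (3.2). [`CheskidovLuo2022`]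
* L. Grafakos, *Classical Fourier Analysis*, 3rd ed. (2014), Prop. 3.2.5, 3.2.6 (8), §3.3.1. [`Grafakos2014`]
-/

noncomputable section

open MeasureTheory Real Set Filter Topology UnitAddTorus

namespace Literature.Analysis.FluidPDE

namespace PerturbedNSFourier

open scoped ComplexConjugate
open ScalarFourier
open CorrectorFourier (leraySym projSym presCoef presCoef_apply convSym convFamily convFamily_zero compC
  driftFam driftCoeff isCoeffFamily_driftFam driftFam_zero_of_mem sum_intCast_mul_driftCoeff
  driftCoeff_neg_eq_conj norm_presSymbol_le norm_intCast_apply_le)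
open LinearisedNSFourier (datumCoeff datumCoeff_apply exists_hasDecay_datumCoeff sum_intCast_mul_datumCoeff
  datumCoeff_zero)
open FourierNS (HasDecay clamp)
open Literature.Analysis.FunctionSpaces.Torus (freqNormSq IsSmooth)

variable {d : Type*} [Fintype d] [DecidableEq d]
variable {ν θ : ℝ} {u : ℝ → UnitAddTorus d → EuclideanSpace ℝ d}
  {v₀ : UnitAddTorus d → EuclideanSpace ℝ d} {Z ρ A : ℝ}

/-! ### The datum -/

omit [DecidableEq d] in
/-- The datum coefficients of a real datum are conjugate symmetric (Grafakos 2014, Prop. 3.2.5). [folklore] -/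
theorem datumCoeff_neg_eq_conj (v₀ : UnitAddTorus d → EuclideanSpace ℝ d) (l : d) (m : d → ℤ) :
    datumCoeff v₀ l (-m) = conj (datumCoeff v₀ l m) := by
  rw [datumCoeff_apply, datumCoeff_apply]
  exact FunctionSpaces.Torus.mFourierCoeff_ofReal_comp (fun x => v₀ x l) m

/-! ### The Picard hypotheses -/

/-- **The Fourier-side data of a smooth background and datum satisfy `PicardHyp`** for
`ν > 0`, `0 < θ ≤ 1`: continuity in time of the drift coefficients at each frequency (the
zeroth members of the drift families are continuous on `[0, θ]`, composed with the continuous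
clamp), every decay uniformly in time (uniform on the compact `[0, θ]`), as
`CorrectorFourier.dataHyp`; every decay of the datum coefficients. [folklore] -/
theorem picardHyp (hν : 0 < ν) (hθ : 0 < θ) (hθ1 : θ ≤ 1)
    (hu : FunctionSpaces.Torus.IsSmoothSpaceTimeOn (Icc 0 θ) u) (hv₀ : IsSmooth v₀) :
    PicardHyp ν θ (driftCoeff θ u) (datumCoeff v₀) := by
  have hUFf : ∀ n j, IsCoeffFamily θ n (driftFam θ u j) := isCoeffFamily_driftFam hθ hu
  refine ⟨hν, hθ, hθ1, fun j m => ?_, fun K => ?_, fun K => ?_⟩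
  · exact ((hUFf 0 j).cont 0 le_rfl m).comp_continuous (FourierNS.continuous_clamp θ)
      fun t => FourierNS.clamp_mem_Icc hθ.le t
  · have h1 : ∀ j, ∃ C : ℝ, 0 ≤ C ∧ ∀ t ∈ Icc 0 θ, HasDecay K C (driftFam θ u j 0 t) := fun j =>
      (hUFf 0 j).decay_nonneg le_rfl K
    choose C hC0 hC using h1
    refine ⟨∑ j, C j, fun j t => ((hC j _ (FourierNS.clamp_mem_Icc hθ.le t)).mono ?_)⟩
    exact Finset.single_le_sum (fun i _ => hC0 i) (Finset.mem_univ j)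
  · obtain ⟨A₀, -, hA₀⟩ := exists_hasDecay_datumCoeff hv₀ K
    exact ⟨A₀, hA₀⟩

/-- **The threshold hypotheses for the data of a smooth background and datum**, given the
threshold numbers: the order-four mass `Z`, a radius `ρ ≥ 0` with the datum coefficients in
the order-four ball of radius `ρ/2`, an order-four constant `A` of the drift coefficients at
all times, and the two threshold inequalities. [folklore] -/
theorem ballHyp (hν : 0 < ν) (hθ : 0 < θ) (hθ1 : θ ≤ 1)
    (hu : FunctionSpaces.Torus.IsSmoothSpaceTimeOn (Icc 0 θ) u) (hv₀ : IsSmooth v₀)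
    (hZ : HasSum (fun m : d → ℤ => ((1 + ‖m‖) ^ 4)⁻¹) Z) (hρ : 0 ≤ ρ) (hA : 0 ≤ A)
    (hUA : ∀ j t, HasDecay 4 A (driftCoeff θ u j t)) (ha : ∀ l, HasDecay 4 (ρ / 2) (datumCoeff v₀ l))
    (hS1 : gainConst ν * Real.sqrt θ * ballConst d Z ρ A ≤ ρ / 2)
    (hS2 : gainConst ν * Real.sqrt θ * lipConst d Z ρ A ≤ 1 / 2) :
    BallHyp ν θ (driftCoeff θ u) (datumCoeff v₀) Z ρ A :=
  { picardHyp hν hθ hθ1 hu hv₀ with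
    hZ := hZ, hρ := hρ, hA := hA, hU4 := hUA, ha4 := ha, hS1 := hS1, hS2 := hS2 }

/-! ### The Fourier-side package of the solution coefficients -/

/-- **The Fourier-side properties of `c = solCoeff ν θ u v₀`** under the threshold hypotheses,
for a jointly smooth divergence-free background `u` on `[0, θ] × T^d` and a smooth
divergence-free mean-zero datum `v₀`: continuity in time, every decay uniformly in time,
Fourier divergence freedom `∑ₗ kₗ c(l,t,k) = 0`, vanishing zero mode `c(l,t,0) = 0`,
conjugation symmetry, the datum `c(l,0,k) = aₗ(k)`, the differentiated mild equation
`∂ₜcₗ = -νₖcₗ - (P G)ₗ` within `[0, θ]`, and coefficient families of every order starting at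
`c` (collected from `PerturbedNSFourierIteration`, `…Regularity`, `…Symmetry`,
`…TimeRegularity`). [folklore] -/
theorem solCoeff_spec (h : BallHyp ν θ (driftCoeff θ u) (datumCoeff v₀) Z ρ A)
    (hu : FunctionSpaces.Torus.IsSmoothSpaceTimeOn (Icc 0 θ) u)
    (hdiv : ∀ t ∈ Icc 0 θ, FunctionSpaces.Torus.IsDivFree (u t))
    (hv₀ : IsSmooth v₀) (hv₀div : FunctionSpaces.Torus.IsDivFree v₀)
    (hv₀mean : FunctionSpaces.Torus.HasZeroMean v₀) :
    (∀ l m, Continuous fun t => solCoeff ν θ u v₀ l t m) ∧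
    (∀ K : ℕ, ∃ C : ℝ, 0 ≤ C ∧ ∀ l t, HasDecay K C (solCoeff ν θ u v₀ l t)) ∧
    (∀ t k, ∑ l, (k l : ℂ) * solCoeff ν θ u v₀ l t k = 0) ∧
    (∀ l t, solCoeff ν θ u v₀ l t 0 = 0) ∧
    (∀ l t k, solCoeff ν θ u v₀ l t (-k) = conj (solCoeff ν θ u v₀ l t k)) ∧
    (∀ l k, solCoeff ν θ u v₀ l 0 k = datumCoeff v₀ l k) ∧
    (∀ l k, ∀ t ∈ Icc 0 θ, HasDerivWithinAt (fun s => solCoeff ν θ u v₀ l s k)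
      (-(heatRate ν k : ℂ) * solCoeff ν θ u v₀ l t k -
        projSym (fun j => driftCoeff θ u j t) 0 (fun j => solCoeff ν θ u v₀ j t) l k) (Icc 0 θ) t) ∧
    (∀ n : ℕ, ∃ W : d → ℕ → ℝ → (d → ℤ) → ℂ, (∀ l, W l 0 = solCoeff ν θ u v₀ l) ∧
      ∀ l, IsCoeffFamily θ n (W l)) := by
  have hadiv : ∀ k, ∑ l, (k l : ℂ) * datumCoeff v₀ l k = 0 := sum_intCast_mul_datumCoeff hv₀ hv₀div
  have ha0 : ∀ l, datumCoeff v₀ l 0 = 0 := datumCoeff_zero hv₀ hv₀mean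
  have hUdiv : ∀ t m, ∑ j, (m j : ℂ) * driftCoeff θ u j t m = 0 :=
    sum_intCast_mul_driftCoeff h.hθ.le hu hdiv
  have hUc : ∀ j t m, driftCoeff θ u j t (-m) = conj (driftCoeff θ u j t m) := driftCoeff_neg_eq_conj θ u
  have hac : ∀ l m, datumCoeff v₀ l (-m) = conj (datumCoeff v₀ l m) := datumCoeff_neg_eq_conj v₀
  refine ⟨h.continuous_picardLim, h.hasDecay_picardLim_all, h.sum_intCast_mul_picardLim hadiv,
    h.picardLim_zero_freq ha0 hadiv hUdiv, h.picardLim_conjSymm hUc hac, h.picardLim_zero_time,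
    fun l k t ht => h.hasDerivWithinAt_picardLim l k ht, fun n => ?_⟩
  exact h.exists_coeffFamily (fun n j => isCoeffFamily_driftFam h.hθ hu n j)
    (fun j t ht => driftFam_zero_of_mem u j ht) n

/-! ### The pressure family -/

/-- **The pressure coefficients start a coefficient family of every order.** With `W` the
velocity families of order `n`, the family `-(2πi|k|²)⁻¹ ∑ₘ kₘ convFamilyₘ` (zero stress
family) is a family of order `n` whose zeroth member agrees with `presCoeffField ν θ u v₀` on
`[0, θ]`; replacing the zeroth member by `presCoeffField ν θ u v₀` itself keeps it a family
(all clauses of `IsCoeffFamily` live on `[0, θ]`; adapted from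
`CorrectorFourier.exists_presFamily`). [folklore] -/
theorem exists_presFamily (hθ : 0 < θ) (hu : FunctionSpaces.Torus.IsSmoothSpaceTimeOn (Icc 0 θ) u) {n : ℕ}
    {W : d → ℕ → ℝ → (d → ℤ) → ℂ} (hW0 : ∀ l, W l 0 = solCoeff ν θ u v₀ l)
    (hW : ∀ l, IsCoeffFamily θ n (W l)) :
    ∃ Q : ℕ → ℝ → (d → ℤ) → ℂ, Q 0 = presCoeffField ν θ u v₀ ∧ IsCoeffFamily θ n Q := by
  have hUFf : ∀ j, IsCoeffFamily θ n (driftFam θ u j) := fun j => isCoeffFamily_driftFam hθ hu n j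
  have hRFf : ∀ i j : d, IsCoeffFamily θ n ((0 : d → d → ℕ → ℝ → (d → ℤ) → ℂ) i j) := fun _ _ =>
    isCoeffFamily_zero θ n
  -- the candidate family
  set Q₀ : ℕ → ℝ → (d → ℤ) → ℂ := fun i t k =>
    (-(1 : ℂ)) / (2 * π * Complex.I * (freqNormSq k : ℂ)) *
      ∑ m, (k m : ℂ) * convFamily (driftFam θ u) 0 W m i t k with hQ₀
  have hQ₀f : IsCoeffFamily θ n Q₀ :=
    (IsCoeffFamily.finset_sum _ fun m _ =>
      (CorrectorFourier.IsCoeffFamily.convFamily hθ hUFf hRFf hW m).symbol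
        (σ := fun k => (k m : ℂ)) (g := 1)
        zero_le_one (norm_intCast_apply_le m)).symbol (g := 0) zero_le_one norm_presSymbol_le
  -- agreement with `presCoeffField` on `[0, θ]`
  have hagree : ∀ t ∈ Icc 0 θ, ∀ k, Q₀ 0 t k = presCoeffField ν θ u v₀ t k := by
    intro t ht k
    have hR' : (fun i j => (0 : d → d → ℕ → ℝ → (d → ℤ) → ℂ) i j 0 t) =
        (0 : d → d → (d → ℤ) → ℂ) := rfl
    simp only [hQ₀, convFamily_zero, presCoeffField_apply, presCoef_apply, hW0, hR']
    have hU' : (fun j => driftFam θ u j 0 t) = fun j => driftCoeff θ u j t :=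
      funext fun j => driftFam_zero_of_mem u j ht
    rw [hU']
    ring
  -- replace the zeroth member
  refine ⟨fun i => if i = 0 then presCoeffField ν θ u v₀ else Q₀ i, by simp, ?_⟩
  refine ⟨fun i hi K => ?_, fun i hi m => ?_, fun i hi m t ht => ?_⟩
  · obtain ⟨C, hC⟩ := hQ₀f.decay i hi K
    refine ⟨C, fun t ht m => ?_⟩
    split_ifs with h0
    · subst h0; rw [← hagree t ht m]; exact hC t ht m
    · exact hC t ht m
  · split_ifs with h0
    · subst h0
      exact (hQ₀f.cont 0 hi m).congr fun t ht => (hagree t ht m).symm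
    · exact hQ₀f.cont i hi m
  · have hd := hQ₀f.deriv i hi m t ht
    have hne : i + 1 ≠ 0 := Nat.succ_ne_zero i
    simp only [hne, if_false]
    split_ifs with h0
    · subst h0
      exact hd.congr (fun s hs => (hagree s hs m).symm) (hagree t ht m).symm
    · exact hd

end PerturbedNSFourier

end Literature.Analysis.FluidPDE

end
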